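import Mathlib
import Summits.AtomisticToContinuum.Crystallization.Theses.GappedShellCensus
import Literature.Geometry.DiscreteGeometry.ShellCensusTwelve
import Literature.Geometry.DiscreteGeometry.KissingFanTriangleSets
import Summits.AtomisticToContinuum.Crystallization.Theorems.GappedShellCensusFiveFoldRationingRStubFfrLens
import Summits.AtomisticToContinuum.Crystallization.Theorems.GappedShellCensusFiveFoldRationingRStubFfrCircle
import Summits.AtomisticToContinuum.Crystallization.Theorems.GappedShellCensusFiveFoldRationingRStubFfrCommonLeFive
import Summits.AtomisticToContinuum.Crystallization.Theorems.GappedShellCensusFiveFoldRationingRStubFfrNoFreeSurface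
import Summits.AtomisticToContinuum.Crystallization.Theorems.GappedShellCensusFiveFoldRationingRStubFfrRelDense
import Summits.AtomisticToContinuum.Crystallization.Theorems.GappedShellCensusFiveFoldRationingRStubFfrParity
import Summits.AtomisticToContinuum.Crystallization.Theorems.GappedShellCensusFiveFoldRationingRStubFfrCountingZ
import Summits.AtomisticToContinuum.Crystallization.Theorems.GappedShellCensusFiveFoldRationingRStubFfrTwoPoles
import Summits.AtomisticToContinuum.Crystallization.Theorems.GappedShellCensusFiveFoldRationingRStubFfrChain
import Summits.AtomisticToContinuum.Crystallization.Theorems.GappedShellCensusFiveFoldRationingRStubFfrLinkGlue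
import Summits.AtomisticToContinuum.Crystallization.Theorems.GappedShellCensusFiveFoldRationingRStubFfrFoamGlue
import Summits.AtomisticToContinuum.Crystallization.Theorems.GappedShellCensusFiveFoldRationingRStubFfrLineCensusC
import Summits.AtomisticToContinuum.Crystallization.Theorems.GappedShellCensusFiveFoldRationingRStubFfrCensus5Aux1
import Summits.AtomisticToContinuum.Crystallization.Theorems.GappedShellCensusFiveFoldRationingRStubFfrCensus5Aux2
import Summits.AtomisticToContinuum.Crystallization.Theorems.GappedShellCensusFiveFoldRationingRStubFfrC5Dict
import Summits.AtomisticToContinuum.Crystallization.Theorems.GappedShellCensusFiveFoldRationingRStubFfrC5Kills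
import Summits.AtomisticToContinuum.Crystallization.Theorems.GappedShellCensusFiveFoldRationingRStubFfrC5Core
import Summits.AtomisticToContinuum.Crystallization.Theorems.GappedShellCensusFiveFoldRationingRStubFfrGreedy
import Summits.AtomisticToContinuum.Crystallization.Theorems.GappedShellCensusFiveFoldRationingRStubFfrQuasiGlue
import Summits.AtomisticToContinuum.Crystallization.Theorems.GappedShellCensusFiveFoldRationingRStubFfrC5CertFacesOf
import Summits.AtomisticToContinuum.Crystallization.Theorems.GappedShellCensusFiveFoldRationingRStubFfrCensus4
import Summits.AtomisticToContinuum.Crystallization.Theorems.GappedShellCensusFiveFoldRationingRStubFfrVolGrowth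
import Summits.AtomisticToContinuum.Crystallization.Theorems.GappedShellCensusFiveFoldRationingRStubFfrRodTransfer
import Summits.AtomisticToContinuum.Crystallization.Theorems.GappedShellCensusFiveFoldRationingRStubFfrC5NoOpenStarEntry
import Summits.AtomisticToContinuum.Crystallization.Theorems.GappedShellCensusFiveFoldRationingRStubFfrC5NoFarFacetEntry
import Literature.Geometry.DiscreteGeometry.ShellCensusReplayEscapeSound
import Literature.Geometry.DiscreteGeometry.ShellCensusReplayEscapeText

/-!
# Skeleton v15 — crux `GappedShellCensus.FiveFoldRationingR` (stmt-AtomisticToContinuum-18071), line `Sketch`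

Lead unit `line-…-18071-c3` (continues v13 of unit c2).  LANDED over c0–c2 (17 registered stubs + 20 helper
files): lens (`stub_ffrLens` p138850), pigeonhole (`stub_ffrCircle` p138989), F1 (`stub_ffrCommonLeFive`
p138519), no free surface (`stub_ffrNoFreeSurface` p138760), relative denseness (`stub_ffrRelDense` p138480),
counting (`stub_ffrCounting` p138682, `stub_ffrCountingZ` p141606), bridge (`stub_ffrBridge` p139807), parity
(`stub_ffrParity` p141236), line census (`stub_ffrLineCensus` p142416, `stub_ffrLineCensusC` p146116), no
branching (`stub_ffrTwoPoles` p143073), walks (`stub_ffrChain` p143517), link glue (`stub_ffrLinkGlue`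
p145354), foam glue (`stub_ffrFoamGlue` p145442), the capped census minus its certificate (`stub_ffrC5Interior`
p145439, `stub_ffrC5NoIcos` p145710, `stub_ffrC5Dict` p151431, `stub_ffrC5Kills` p151847, `stub_ffrC5Core`
p152930, `stub_ffrC5CertFacesOf` p149940, `stub_ffrC5CertFacetSign` p150789), greedy routing
(`stub_ffrGreedy` p151582 + Fan/Core/Spread) and the quasi-geodesy glue (`stub_ffrQuasiGlue` p153257).

RESHAPE v14 (this unit): the three open stubs of v13 are re-cut into SIX registered stubs, four of them
provable now or by a computational lane, two deep:
* `stub_ffrCensus4` (unchanged) = the sibling crux 18070's `stub_census` (their finite census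
  `Literature/…/ShellCensusSearch*` is landing; close by `exact stub_census`);
* the certificate `stub_ffrC5CertX` is DERIVED (`ffr_c5certX_of`, sorry-free, via the landed dictionary half
  `stub_ffrC5CertFacesOf`) from two ELEMENTARY stubs, each the target of one box-search certificate on the
  `ShellCensusReplay` checker: `stub_ffrC5NoFarFacet` (C2: no hull facet of the normalised shell with two far
  sides — facet leaf `aboveFacet` sound by `stub_ffrC5CertFacetSign`) and `stub_ffrC5NoOpenStar` (C1: no open
  `4T+Q` star; thin, onset (2.5 %, 2.75 %]);
* the rod `stub_ffrRod` is DERIVED (`ffr_rod_of`) from `stub_ffrVolGrowth` (provable: hard core + relative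
  denseness ⇒ `n³` sites in `B(p, 13an)`), `stub_ffrRodTransfer` (provable plumbing: bond graph on `↥Y`) and ONE
  deep, VOCABULARY-FREE, PURELY GRAPH-THEORETIC stub `stub_ffrRodGraph` (connected graph with
  cubocta/anticubocta/prism labelled links and cubic ball growth ⇒ axis uniqueness + height function).
WAVE 1 (this unit, v15): LANDED `stub_ffrCensus4` p156728 (computational), `stub_ffrVolGrowth` p156484, `stub_ffrRodTransfer`
p157521 (+Aux p156958), the certificate ENTRY theorems `ffr_noOpenStar_of_infeasible` p156920 / `ffr_noFarFacet_of_infeasible`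
p157336, and the checker extension `Literature/…/ShellCensusReplayEscape{,Sound,Text}.lean` p157173/p157796/p157801 (degree escapes,
facet leaf, text format, `ECensus.infeasible_of_check`).  Open (v15): THREE stubs — `stub_ffrC5NoFarFacet`, `stub_ffrC5NoOpenStar` (each now =
one certificate text accepted by `ECensus.check`, to be produced on the farm) and the deep graph theorem `stub_ffrRodGraph`.
`fiveFoldRationingR_of` is kernel-checked modulo these three `stub_*` sorries.
-/

noncomputable section

namespace Summit.AtomisticToContinuum.Crystallization.Theorems

open Summit.AtomisticToContinuum.Crystallization.Theses.GappedShellCensus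
open Literature.Geometry.DiscreteGeometry

/-! ## L — the single-shell layer -/

/-! `stub_ffrCensus4` (degree-four census = sibling 18070's `stub_census`) LANDED p156728 (module …StubFfrCensus4, computational: the
sibling's finite census `ShellCensusSearch*` assembled by `ffrC4_censusFinite`) — imported. -/

/-! ## D — the dictionary (geometry → labelled fan data), degrees `≥ 4` -/

/-! ## C — the certificate (metric exclusions at tolerance `1/50`), two elementary targets -/

/-- **Stub C2′ (NO FAR-FAR FACET; certificate lane).** For a gapped twelve-tuple with shell-degrees in
`[4, 5]`, no three distinct labels `p, q, r` with `pq` and `pr` FAR carry a supporting functional of the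
normalised shell `u k = t k / ‖t k‖` (a vector `c` with `⟪c, u p⟫ = ⟪c, u q⟫ = ⟪c, u r⟫ = 1` and `⟪c, u l⟫ ≤ 1`
for all `l`) — i.e. no facet of the radial hull has two far sides (equivalently: no empty `≥ 5`-gon face of
the bond graph; numerically infeasible up to τ ≈ 4.25 %, nearest family the hexagonal antiprism).  Target of a
framed box-search certificate on `Literature/…/ShellCensusReplay` extended by degree escapes (`torn`: a label
with `≥ 8` decided far partners; `capped`: `≥ 6` decided bonds) and the facet leaf `aboveFacet` (interval sign
of the polynomial of `stub_ffrC5CertFacetSign`, p150789). [folklore] -/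
theorem stub_ffrC5NoFarFacet (t : Fin 12 → EuclideanSpace ℝ (Fin 3))
    (hn : ∀ k, 1 - 1 / 50 ≤ ‖t k‖ ∧ ‖t k‖ ≤ 1 + 1 / 50)
    (hd : ∀ k l, k ≠ l → 1 - 1 / 50 ≤ dist (t k) (t l) ∧ (dist (t k) (t l) ≤ 1 + 1 / 50 ∨ 63 / 50 ≤ dist (t k) (t l)))
    (h4 : ∀ k, 4 ≤ (Finset.univ.filter fun l => l ≠ k ∧ dist (t k) (t l) ≤ 1 + 1 / 50).card)
    (h5 : ∀ k, (Finset.univ.filter fun l => l ≠ k ∧ dist (t k) (t l) ≤ 1 + 1 / 50).card ≤ 5) :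
    ∀ p q r : Fin 12, p ≠ q → p ≠ r → q ≠ r →
      63 / 50 ≤ dist (t p) (t q) → 63 / 50 ≤ dist (t p) (t r) →
      (∃ c : EuclideanSpace ℝ (Fin 3), inner ℝ c (‖t p‖⁻¹ • t p) = 1 ∧ inner ℝ c (‖t q‖⁻¹ • t q) = 1 ∧
        inner ℝ c (‖t r‖⁻¹ • t r) = 1 ∧ ∀ l, inner ℝ c (‖t l‖⁻¹ • t l) ≤ 1) → False := by
  sorry

/-- **Stub C1′ (NO OPEN `4T+Q` STAR; certificate lane, thin: ≈ 0.5 % of τ).** For a gapped twelve-tuple with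
shell-degrees in `[4, 5]` there are no seven distinct labels `v, a₁, …, a₅, x` with `v` bonded to every `aᵢ`,
bonds `a₁a₂, a₂a₃, a₃a₄, a₄a₅`, the pair `a₅a₁` far, `x` bonded to `a₅` and `a₁` and far from `v` (the bare
7-point motif is pairwise legal at `1/50`, `Negative/OpenStar.lean`; the twelve-shell kills it: forced-motif
scans infeasible at `1/50`, feasible at `3/100`, `Negative/ToleranceOnset.lean`).  Target of a framed
box-search certificate (constraint list of 13 decided pairs on labels `0…6`; degree escapes as in
`stub_ffrC5NoFarFacet`). [folklore] -/
theorem stub_ffrC5NoOpenStar (t : Fin 12 → EuclideanSpace ℝ (Fin 3))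
    (hn : ∀ k, 1 - 1 / 50 ≤ ‖t k‖ ∧ ‖t k‖ ≤ 1 + 1 / 50)
    (hd : ∀ k l, k ≠ l → 1 - 1 / 50 ≤ dist (t k) (t l) ∧ (dist (t k) (t l) ≤ 1 + 1 / 50 ∨ 63 / 50 ≤ dist (t k) (t l)))
    (h4 : ∀ k, 4 ≤ (Finset.univ.filter fun l => l ≠ k ∧ dist (t k) (t l) ≤ 1 + 1 / 50).card)
    (h5 : ∀ k, (Finset.univ.filter fun l => l ≠ k ∧ dist (t k) (t l) ≤ 1 + 1 / 50).card ≤ 5) :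
    ∀ v a₁ a₂ a₃ a₄ a₅ x : Fin 12, Function.Injective ![v, a₁, a₂, a₃, a₄, a₅, x] →
      dist (t v) (t a₁) ≤ 1 + 1 / 50 → dist (t v) (t a₂) ≤ 1 + 1 / 50 → dist (t v) (t a₃) ≤ 1 + 1 / 50 →
      dist (t v) (t a₄) ≤ 1 + 1 / 50 → dist (t v) (t a₅) ≤ 1 + 1 / 50 →
      dist (t a₁) (t a₂) ≤ 1 + 1 / 50 → dist (t a₂) (t a₃) ≤ 1 + 1 / 50 → dist (t a₃) (t a₄) ≤ 1 + 1 / 50 →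
      dist (t a₄) (t a₅) ≤ 1 + 1 / 50 → 63 / 50 ≤ dist (t a₅) (t a₁) →
      dist (t x) (t a₅) ≤ 1 + 1 / 50 → dist (t x) (t a₁) ≤ 1 + 1 / 50 → 63 / 50 ≤ dist (t v) (t x) → False := by
  sorry

/-- **The certificate conjunction, DERIVED** (statement = the former `stub_ffrC5CertX` verbatim): (C2) from
`stub_ffrC5NoFarFacet` through the landed dictionary half `stub_ffrC5CertFacesOf` (p149940), (C1) =
`stub_ffrC5NoOpenStar`. -/
theorem ffr_c5certX_of (t : Fin 12 → EuclideanSpace ℝ (Fin 3))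
    (hn : ∀ k, 1 - 1 / 50 ≤ ‖t k‖ ∧ ‖t k‖ ≤ 1 + 1 / 50)
    (hd : ∀ k l, k ≠ l → 1 - 1 / 50 ≤ dist (t k) (t l) ∧ (dist (t k) (t l) ≤ 1 + 1 / 50 ∨ 63 / 50 ≤ dist (t k) (t l)))
    (h4 : ∀ k, 4 ≤ (Finset.univ.filter fun l => l ≠ k ∧ dist (t k) (t l) ≤ 1 + 1 / 50).card)
    (h5 : ∀ k, (Finset.univ.filter fun l => l ≠ k ∧ dist (t k) (t l) ≤ 1 + 1 / 50).card ≤ 5) :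
    (∀ S ∈ (Finset.univ.powerset.filter fun S : Finset (Fin 12) =>
        S.image (fun k => ‖t k‖⁻¹ • t k) ∈
          Literature.Geometry.DiscreteGeometry.fanTriSets (Finset.univ.image fun k => ‖t k‖⁻¹ • t k)),
      ∃ a ∈ S, ∀ b ∈ S, b ≠ a → dist (t a) (t b) ≤ 1 + 1 / 50) ∧
    (∀ v a₁ a₂ a₃ a₄ a₅ x : Fin 12, Function.Injective ![v, a₁, a₂, a₃, a₄, a₅, x] →
      dist (t v) (t a₁) ≤ 1 + 1 / 50 → dist (t v) (t a₂) ≤ 1 + 1 / 50 → dist (t v) (t a₃) ≤ 1 + 1 / 50 →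
      dist (t v) (t a₄) ≤ 1 + 1 / 50 → dist (t v) (t a₅) ≤ 1 + 1 / 50 →
      dist (t a₁) (t a₂) ≤ 1 + 1 / 50 → dist (t a₂) (t a₃) ≤ 1 + 1 / 50 → dist (t a₃) (t a₄) ≤ 1 + 1 / 50 →
      dist (t a₄) (t a₅) ≤ 1 + 1 / 50 → 63 / 50 ≤ dist (t a₅) (t a₁) →
      dist (t x) (t a₅) ≤ 1 + 1 / 50 → dist (t x) (t a₁) ≤ 1 + 1 / 50 → 63 / 50 ≤ dist (t v) (t x) → False) :=
  ⟨stub_ffrC5CertFacesOf t hn hd (stub_ffrC5NoFarFacet t hn hd h4 h5), stub_ffrC5NoOpenStar t hn hd h4 h5⟩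

/-! ## K — the angle-budget kills (abstract fan data) -/

/-! ## F — the finite core (abstract fan data) -/

/-! ## The glue: `stub_ffrCensus5` from D + C + K + F + the landed icosahedron kill -/

/-- **`stub_ffrCensus5`, DERIVED** (sorry-free glue): all-five tuples die by `stub_ffrC5NoIcos`;
otherwise the dictionary, the certificate, the kills and the core give the prism. -/
theorem ffr_census5_of :
    (∀ t : Fin 12 → EuclideanSpace ℝ (Fin 3), Function.Injective t →
        (∀ k, 1 - 1 / 50 ≤ ‖t k‖ ∧ ‖t k‖ ≤ 1 + 1 / 50) →
        (∀ k l, k ≠ l → 1 - 1 / 50 ≤ dist (t k) (t l) ∧ (dist (t k) (t l) ≤ 1 + 1 / 50 ∨ 63 / 50 ≤ dist (t k) (t l))) →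
        (∀ k, 4 ≤ (Finset.univ.filter fun l => l ≠ k ∧ dist (t k) (t l) ≤ 1 + 1 / 50).card) →
        (∀ k, (Finset.univ.filter fun l => l ≠ k ∧ dist (t k) (t l) ≤ 1 + 1 / 50).card ≤ 5) →
        (∃ k, 5 ≤ (Finset.univ.filter fun l => l ≠ k ∧ dist (t k) (t l) ≤ 1 + 1 / 50).card) →
        ∃ σ : Equiv.Perm (Fin 12), ∀ k l : Fin 12, k < l →
          (dist (t (σ k)) (t (σ l)) ≤ 1 + 1 / 50 ↔ (k.val, l.val) ∈ ([(0, 1), (0, 2), (0, 3), (0, 4), (0, 5), (1, 2), (1, 5), (1, 6), (2, 3), (2, 7), (3, 4),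
                (3, 8), (4, 5), (4, 9), (5, 10), (6, 7), (6, 10), (6, 11), (7, 8), (7, 11), (8, 9),
                (8, 11), (9, 10), (9, 11), (10, 11)] : List (ℕ × ℕ)))) := by
  intro t hinj hn hd h4 h5 h5ex
  -- the all-five case is the icosahedron kill
  by_cases hall : ∀ k, (Finset.univ.filter fun l => l ≠ k ∧ dist (t k) (t l) ≤ 1 + 1 / 50).card = 5
  · exact (stub_ffrC5NoIcos t hn hd hall).elim
  -- dictionary and certificate on the concrete fan data
  obtain ⟨⟨tri_card, card_tri, two_per_side, bond_side, bond_tri, link⟩,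
    ⟨ang_nonneg, ang_zero, sum_ang, tCorner, tCornerMin, hCorner, qCorner, qCornerMin, hPairMin⟩⟩ :=
    stub_ffrC5Dict t hinj hn hd h4
  obtain ⟨c2, c1⟩ := ffr_c5certX_of t hn hd h4 h5
  -- the bond relation as a Boolean
  set bond : Fin 12 → Fin 12 → Bool := fun v w => decide (v ≠ w ∧ dist (t v) (t w) ≤ 1 + 1 / 50) with hbdef
  have hbond : ∀ v w, bond v w = true ↔ v ≠ w ∧ dist (t v) (t w) ≤ 1 + 1 / 50 := fun v w => by
    simp only [hbdef, decide_eq_true_eq]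
  have hfar : ∀ v w, bond v w = false → v ≠ w → 63 / 50 ≤ dist (t v) (t w) := by
    intro v w h hvw
    have h' : ¬ (v ≠ w ∧ dist (t v) (t w) ≤ 1 + 1 / 50) := fun hh => by
      rw [(hbond v w).2 hh] at h; exact Bool.noConfusion h
    rcases (hd v w hvw).2 with hle | hge
    · exact absurd ⟨hvw, hle⟩ h'
    · exact hge
  have bond_symm : ∀ v w, bond v w = bond w v := by
    intro v w
    rcases Bool.eq_false_or_eq_true (bond v w) with h | h <;>
      rcases Bool.eq_false_or_eq_true (bond w v) with h' | h' <;> rw [h, h']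
    · exfalso
      have := (hbond v w).1 h
      rw [dist_comm] at this
      exact Bool.eq_false_iff.1 h' |>.elim ((hbond w v).2 ⟨this.1.symm, this.2⟩)
    · exfalso
      have := (hbond w v).1 h'
      rw [dist_comm] at this
      exact Bool.eq_false_iff.1 h |>.elim ((hbond v w).2 ⟨this.1.symm, this.2⟩)
  have bond_irrefl : ∀ v, bond v v = false := fun v =>
    Bool.eq_false_iff.2 fun h => ((hbond v v).1 h).1 rfl
  have hdegEq : ∀ v, (Finset.univ.filter fun w => bond v w = true).card =
      (Finset.univ.filter fun l => l ≠ v ∧ dist (t v) (t l) ≤ 1 + 1 / 50).card := by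
    intro v
    congr 1
    ext w
    simp only [Finset.mem_filter, Finset.mem_univ, true_and, hbond v w, ne_comm]
  have bond_deg : ∀ v, 4 ≤ (Finset.univ.filter fun w => bond v w = true).card ∧
      (Finset.univ.filter fun w => bond v w = true).card ≤ 5 := fun v => by
    rw [hdegEq v]; exact ⟨h4 v, h5 v⟩
  have h5ex' : ∃ v, (Finset.univ.filter fun w => bond v w = true).card = 5 := by
    obtain ⟨k, hk⟩ := h5ex
    exact ⟨k, by rw [hdegEq k]; exact le_antisymm (h5 k) hk⟩
  have h4ex' : ∃ v, (Finset.univ.filter fun w => bond v w = true).card = 4 := by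
    push Not at hall
    obtain ⟨k, hk⟩ := hall
    refine ⟨k, ?_⟩
    rw [hdegEq k]
    have h4k := h4 k
    have h5k := h5 k
    omega
  -- the dictionary in Boolean form
  have bond_side' : ∀ v w, bond v w = true →
      ((Finset.univ.powerset.filter fun S => S.image (fun k => ‖t k‖⁻¹ • t k) ∈
          fanTriSets (Finset.univ.image fun k => ‖t k‖⁻¹ • t k)).filter
        fun S' => ({v, w} : Finset (Fin 12)) ⊆ S').card = 2 := fun v w h =>
    bond_side v w ((hbond v w).1 h).1 ((hbond v w).1 h).2
  have bond_tri' : ∀ a b c, a ≠ b → b ≠ c → a ≠ c → bond a b = true → bond b c = true → bond a c = true →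
      ({a, b, c} : Finset (Fin 12)) ∈
        (Finset.univ.powerset.filter fun S => S.image (fun k => ‖t k‖⁻¹ • t k) ∈
          fanTriSets (Finset.univ.image fun k => ‖t k‖⁻¹ • t k)) :=
    fun a b c hab hbc hac h1 h2 h3 =>
      bond_tri a b c hab hbc hac ((hbond a b).1 h1).2 ((hbond b c).1 h2).2 ((hbond a c).1 h3).2
  have tCorner' := fun S hS (hall' : ∀ v ∈ S, ∀ w ∈ S, v ≠ w → bond v w = true) v hv =>
    tCorner S hS (fun v hv w hw hvw => ((hbond v w).1 (hall' v hv w hw hvw)).2) v hv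
  have tCornerMin' := fun S hS (hall' : ∀ v ∈ S, ∀ w ∈ S, v ≠ w → bond v w = true) v hv =>
    tCornerMin S hS (fun v hv w hw hvw => ((hbond v w).1 (hall' v hv w hw hvw)).2) v hv
  have hCorner' := fun v a x hS (h1 : bond v a = true) (h2 : bond a x = true) (h3 : bond v x = false)
      (hvx : v ≠ x) =>
    hCorner v a x hS ((hbond v a).1 h1).2 ((hbond a x).1 h2).2 (hfar v x h3 hvx)
  have qCorner' := fun v d a x hS (h1 : bond v d = true) (h2 : bond v a = true) (h3 : bond d a = false)
      (hda : d ≠ a) (h4' : bond d x = true) (h5' : bond x a = true) (h6 : bond v x = false) (hxv : x ≠ v) =>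
    qCorner v d a x hS ((hbond v d).1 h1).2 ((hbond v a).1 h2).2 (hfar d a h3 hda)
      ((hbond d x).1 h4').2 ((hbond x a).1 h5').2 (hfar v x h6 hxv.symm)
  have qCornerMin' := fun v d a hS (h1 : bond v d = true) (h2 : bond v a = true) (h3 : bond d a = false)
      (hda : d ≠ a) =>
    qCornerMin v d a hS ((hbond v d).1 h1).2 ((hbond v a).1 h2).2 (hfar d a h3 hda)
  have hPairMin' := fun v a x z hS hS' (h1 : bond v a = true) (h2 : bond v z = true) (h3 : bond a z = false)
      (haz : a ≠ z) =>
    hPairMin v a x z hS hS' ((hbond v a).1 h1).2 ((hbond v z).1 h2).2 (hfar a z h3 haz)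
  -- the certificate in Boolean form
  have two_bond_sides : ∀ S ∈ (Finset.univ.powerset.filter fun S => S.image (fun k => ‖t k‖⁻¹ • t k) ∈
      fanTriSets (Finset.univ.image fun k => ‖t k‖⁻¹ • t k)),
      ∃ a ∈ S, ∀ b ∈ S, b ≠ a → bond a b = true := by
    intro S hS
    obtain ⟨a, ha, h⟩ := c2 S hS
    exact ⟨a, ha, fun b hb hba => (hbond a b).2 ⟨hba.symm, h b hb hba⟩⟩
  have noOpenStar : ∀ v a₁ a₂ a₃ a₄ a₅ x : Fin 12, Function.Injective ![v, a₁, a₂, a₃, a₄, a₅, x] →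
      bond v a₁ = true → bond v a₂ = true → bond v a₃ = true → bond v a₄ = true → bond v a₅ = true →
      bond a₁ a₂ = true → bond a₂ a₃ = true → bond a₃ a₄ = true → bond a₄ a₅ = true → bond a₅ a₁ = false →
      bond x a₅ = true → bond x a₁ = true → bond v x = false → False := by
    intro v a₁ a₂ a₃ a₄ a₅ x hι b1 b2 b3 b4 b5 p1 p2 p3 p4 f51 x5 x1 fvx
    have h51 : a₅ ≠ a₁ := fun h => by
      have := hι (a₁ := 5) (a₂ := 1) (by simp [h])
      exact absurd this (by decide)
    have hvx : v ≠ x := fun h => by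
      have := hι (a₁ := 0) (a₂ := 6) (by simp [h])
      exact absurd this (by decide)
    exact c1 v a₁ a₂ a₃ a₄ a₅ x hι ((hbond _ _).1 b1).2 ((hbond _ _).1 b2).2 ((hbond _ _).1 b3).2
      ((hbond _ _).1 b4).2 ((hbond _ _).1 b5).2 ((hbond _ _).1 p1).2 ((hbond _ _).1 p2).2
      ((hbond _ _).1 p3).2 ((hbond _ _).1 p4).2 (hfar _ _ f51 h51) ((hbond _ _).1 x5).2
      ((hbond _ _).1 x1).2 (hfar _ _ fvx hvx)
  -- kills, core
  obtain ⟨five_T, four_T⟩ := stub_ffrC5Kills bond _ _ bond_symm bond_irrefl bond_deg tri_card card_tri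
    two_per_side bond_side' bond_tri' link ang_nonneg ang_zero sum_ang tCorner' tCornerMin' hCorner'
    qCorner' qCornerMin' hPairMin' two_bond_sides noOpenStar
  obtain ⟨σ, hσ⟩ := stub_ffrC5Core bond _ bond_symm bond_irrefl bond_deg h4ex' h5ex' tri_card card_tri
    two_per_side bond_side' bond_tri' link two_bond_sides five_T four_T
  refine ⟨σ, fun k l hkl => ?_⟩
  rw [← hσ k l hkl, hbond]
  exact ⟨fun h => ⟨σ.injective.ne (ne_of_lt hkl), h⟩, fun h => h.2⟩


/-- **Link types, composed** (L4 + derived L5 + landed glue). -/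
theorem ffr_linkTypes_of :
    ∀ (Y : Set (EuclideanSpace ℝ (Fin 3))) (a : ℝ), 0 < a →
      (∀ y ∈ Y, ({w ∈ Y | w ≠ y ∧ dist y w ≤ a * (1 + 1 / 50)}.ncard = 12 ∧
        ∀ w ∈ Y, w ≠ y → a * (1 - 1 / 50) ≤ dist y w ∧
          (dist y w ≤ a * (1 + 1 / 50) ∨ a * (63 / 50) ≤ dist y w))) →
      (∀ y ∈ Y, ∀ v ∈ Y, v ≠ y → dist y v ≤ a * (1 + 1 / 50) →
        4 ≤ {w ∈ Y | w ≠ y ∧ w ≠ v ∧ dist y w ≤ a * (1 + 1 / 50) ∧ dist v w ≤ a * (1 + 1 / 50)}.ncard) →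
      (∀ y ∈ Y, ∀ v ∈ Y, v ≠ y → dist y v ≤ a * (1 + 1 / 50) →
        {w ∈ Y | w ≠ y ∧ w ≠ v ∧ dist y w ≤ a * (1 + 1 / 50) ∧ dist v w ≤ a * (1 + 1 / 50)}.ncard ≤ 5) →
      (∀ y ∈ Y, ∃ e : Fin 12 → EuclideanSpace ℝ (Fin 3), Function.Injective e ∧
        Set.range e = {w ∈ Y | w ≠ y ∧ dist y w ≤ a * (1 + 1 / 50)} ∧
        ((∀ i j : Fin 12, i < j → (dist (e i) (e j) ≤ a * (1 + 1 / 50) ↔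
            (i.val, j.val) ∈ ([(0, 4), (0, 5), (0, 8), (0, 9), (1, 4), (1, 5), (1, 10), (1, 11), (2, 6), (2, 7),
                (2, 8), (2, 9), (3, 6), (3, 7), (3, 10), (3, 11), (4, 8), (4, 10), (5, 9), (5, 11),
                (6, 8), (6, 10), (7, 9), (7, 11)] : List (ℕ × ℕ)))) ∨
          (∀ i j : Fin 12, i < j → (dist (e i) (e j) ≤ a * (1 + 1 / 50) ↔
            (i.val, j.val) ∈ ([(0, 2), (0, 5), (0, 7), (0, 10), (1, 3), (1, 4), (1, 8), (1, 11), (2, 4), (2, 6),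
                (2, 9), (3, 5), (3, 8), (3, 11), (4, 6), (4, 9), (5, 7), (5, 10), (6, 7), (6, 8),
                (7, 8), (9, 10), (9, 11), (10, 11)] : List (ℕ × ℕ)))) ∨
          (∀ i j : Fin 12, i < j → (dist (e i) (e j) ≤ a * (1 + 1 / 50) ↔
            (i.val, j.val) ∈ ([(0, 1), (0, 2), (0, 3), (0, 4), (0, 5), (1, 2), (1, 5), (1, 6), (2, 3), (2, 7), (3, 4),
                (3, 8), (4, 5), (4, 9), (5, 10), (6, 7), (6, 10), (6, 11), (7, 8), (7, 11), (8, 9),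
                (8, 11), (9, 10), (9, 11), (10, 11)] : List (ℕ × ℕ)))))) :=
  fun Y a ha hgap htf hF1 => stub_ffrLinkGlue Y a ha hgap htf hF1 stub_ffrCensus4 ffr_census5_of

/-! ## F — the global layer -/

/-! `stub_ffrVolGrowth` LANDED p156484 (…StubFfrVolGrowth) and `stub_ffrRodTransfer` LANDED p157521 (…StubFfrRodTransfer + Aux p156958) — imported. -/

/-- **Stub RG (THE ROD AS A PURE GRAPH THEOREM — deep; the lead's stub).** Let `G` be a connected simple
graph in which the neighbourhood of every vertex carries an injective labelling by `Fin 12` whose induced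
adjacency is EXACTLY the cuboctahedral (fcc), the anticuboctahedral (hcp) or the bicapped-pentagonal-prism
(decahedral axis) edge list, and whose balls grow at least cubically.  Call `v` a FIVE-BOND partner of `y`
if `y ~ v` with `≥ 5` common neighbours (this happens iff `y` is prism-labelled and `v` is one of its two
poles), and `y` a FIVE-SITE if it has one.  Then (a) AXIS UNIQUENESS: any two five-sites are joined by a
walk along five-bonds; (b) HEIGHT: there is `h : V → ℝ` with `|h u − h v| ≤ 1` on edges, `= 1` on
five-bonds, and `h v + h v' = 2 h y` for the two five-bond partners `v ≠ v'` of `y`.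
Intended proof: COMBINATORIAL ROD RIGIDITY — type adjacency from the common-neighbour graphs (matching ↔
TQTQ, `P₃ + pt` ↔ TTQQ, `C₅` ↔ pole); sheets (hexagons of A-vertices, rings of P-vertices) and chambers;
the universal cover of the triangle/quad face complex develops chamber-wise into the fcc lattice; no
chamber cross-section has two `θ_T`-corners (`2·70.53° < 180°` forces a bounded polygon, and
`n·70.53° ≠ (n − 2)·180°`); hence a connected such graph with a prism vertex is a quotient `D/Γ` of the
rod `D` (axis `ℤ`, five fcc wedges glued along five twin half-sheets) by a free group `Γ` of axial
automorphisms; `Γ ≠ 1` has quadratic ball growth, excluded by the hypothesis; on `D`, `h` = half the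
axial coordinate.  No metric, no `ℝ³`: this is the item to promote if it outlives the line
(memo Lines/Sketch.md §5, ITEM R-def/R-rig/R-cov, now vocabulary-free). [folklore] -/
theorem stub_ffrRodGraph :
    ∀ (V : Type) (G : SimpleGraph V),
      (∀ v : V, ∃ e : Fin 12 → V, Function.Injective e ∧ Set.range e = {w | G.Adj v w} ∧
        ((∀ i j : Fin 12, i < j → (G.Adj (e i) (e j) ↔
            (i.val, j.val) ∈ ([(0, 4), (0, 5), (0, 8), (0, 9), (1, 4), (1, 5), (1, 10), (1, 11), (2, 6), (2, 7),
                (2, 8), (2, 9), (3, 6), (3, 7), (3, 10), (3, 11), (4, 8), (4, 10), (5, 9), (5, 11),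
                (6, 8), (6, 10), (7, 9), (7, 11)] : List (ℕ × ℕ)))) ∨
          (∀ i j : Fin 12, i < j → (G.Adj (e i) (e j) ↔
            (i.val, j.val) ∈ ([(0, 2), (0, 5), (0, 7), (0, 10), (1, 3), (1, 4), (1, 8), (1, 11), (2, 4), (2, 6),
                (2, 9), (3, 5), (3, 8), (3, 11), (4, 6), (4, 9), (5, 7), (5, 10), (6, 7), (6, 8),
                (7, 8), (9, 10), (9, 11), (10, 11)] : List (ℕ × ℕ)))) ∨
          (∀ i j : Fin 12, i < j → (G.Adj (e i) (e j) ↔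
            (i.val, j.val) ∈ ([(0, 1), (0, 2), (0, 3), (0, 4), (0, 5), (1, 2), (1, 5), (1, 6), (2, 3), (2, 7), (3, 4),
                (3, 8), (4, 5), (4, 9), (5, 10), (6, 7), (6, 10), (6, 11), (7, 8), (7, 11), (8, 9),
                (8, 11), (9, 10), (9, 11), (10, 11)] : List (ℕ × ℕ)))))) →
      G.Connected →
      (∃ (r₀ : ℕ) (c : ℝ), 0 < c ∧ ∀ (v : V) (r : ℕ), r₀ ≤ r →
        c * (r : ℝ) ^ 3 ≤ (({w | G.dist v w ≤ r} : Set V).ncard : ℝ)) →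
      (∀ y ∈ {y : V | ∃ v, G.Adj y v ∧ 5 ≤ ({w | G.Adj y w ∧ G.Adj v w} : Set V).ncard},
        ∀ y' ∈ {y : V | ∃ v, G.Adj y v ∧ 5 ≤ ({w | G.Adj y w ∧ G.Adj v w} : Set V).ncard},
        ∃ f : ℕ → V, f 0 = y ∧
          (∀ n, f (n + 1) ∈ {v | G.Adj (f n) v ∧ 5 ≤ ({w | G.Adj (f n) w ∧ G.Adj v w} : Set V).ncard}) ∧
          ∃ n, f n = y') ∧
      (∃ h : V → ℝ,
        (∀ u v : V, G.Adj u v → |h u - h v| ≤ 1) ∧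
        (∀ y : V, ∀ v ∈ {v | G.Adj y v ∧ 5 ≤ ({w | G.Adj y w ∧ G.Adj v w} : Set V).ncard}, |h y - h v| = 1) ∧
        (∀ y : V, ∀ v ∈ {v | G.Adj y v ∧ 5 ≤ ({w | G.Adj y w ∧ G.Adj v w} : Set V).ncard},
          ∀ v' ∈ {v | G.Adj y v ∧ 5 ≤ ({w | G.Adj y w ∧ G.Adj v w} : Set V).ncard},
          v ≠ v' → h v + h v' = 2 * h y)) := by
  sorry

/-- **The rod on `Y`, DERIVED** (RT ∘ (RG, VG)); statement = the former `stub_ffrRod` verbatim. -/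
theorem ffr_rod_of :
    ∀ (Y : Set (EuclideanSpace ℝ (Fin 3))) (a : ℝ), 0 < a → Y.Nonempty →
      (∀ y ∈ Y, ({w ∈ Y | w ≠ y ∧ dist y w ≤ a * (1 + 1 / 50)}.ncard = 12 ∧
        ∀ w ∈ Y, w ≠ y → a * (1 - 1 / 50) ≤ dist y w ∧
          (dist y w ≤ a * (1 + 1 / 50) ∨ a * (63 / 50) ≤ dist y w))) →
      (∀ y ∈ Y, ∀ v ∈ Y, v ≠ y → dist y v ≤ a * (1 + 1 / 50) →
        4 ≤ {w ∈ Y | w ≠ y ∧ w ≠ v ∧ dist y w ≤ a * (1 + 1 / 50) ∧ dist v w ≤ a * (1 + 1 / 50)}.ncard) →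
      (∀ y ∈ Y, ∀ v ∈ Y, v ≠ y → dist y v ≤ a * (1 + 1 / 50) →
        {w ∈ Y | w ≠ y ∧ w ≠ v ∧ dist y w ≤ a * (1 + 1 / 50) ∧ dist v w ≤ a * (1 + 1 / 50)}.ncard ≤ 5) →
      (∀ y ∈ Y, Even {v ∈ Y | v ≠ y ∧ dist y v ≤ a * (1 + 1 / 50) ∧
          5 ≤ {w ∈ Y | w ≠ y ∧ w ≠ v ∧ dist y w ≤ a * (1 + 1 / 50) ∧
            dist v w ≤ a * (1 + 1 / 50)}.ncard}.ncard) →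
      (∀ y ∈ Y, {v ∈ Y | v ≠ y ∧ dist y v ≤ a * (1 + 1 / 50) ∧
          5 ≤ {w ∈ Y | w ≠ y ∧ w ≠ v ∧ dist y w ≤ a * (1 + 1 / 50) ∧
            dist v w ≤ a * (1 + 1 / 50)}.ncard} = ∅ ∨
        ({v ∈ Y | v ≠ y ∧ dist y v ≤ a * (1 + 1 / 50) ∧
          5 ≤ {w ∈ Y | w ≠ y ∧ w ≠ v ∧ dist y w ≤ a * (1 + 1 / 50) ∧
            dist v w ≤ a * (1 + 1 / 50)}.ncard}).ncard = 2) →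
      (∀ y₀ ∈ Y, ∀ v₀ ∈ {v ∈ Y | v ≠ y₀ ∧ dist y₀ v ≤ a * (1 + 1 / 50) ∧
          5 ≤ {w ∈ Y | w ≠ y₀ ∧ w ≠ v ∧ dist y₀ w ≤ a * (1 + 1 / 50) ∧
            dist v w ≤ a * (1 + 1 / 50)}.ncard},
        ∃ f : ℕ → EuclideanSpace ℝ (Fin 3), f 0 = y₀ ∧ f 1 = v₀ ∧ (∀ n, f n ∈ Y) ∧
          (∀ n, f (n + 1) ∈ {v ∈ Y | v ≠ (f n) ∧ dist (f n) v ≤ a * (1 + 1 / 50) ∧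
          5 ≤ {w ∈ Y | w ≠ (f n) ∧ w ≠ v ∧ dist (f n) w ≤ a * (1 + 1 / 50) ∧
            dist v w ≤ a * (1 + 1 / 50)}.ncard}) ∧
          (∀ n, f (n + 2) ≠ f n)) →
      (∀ y ∈ Y, ∃ e : Fin 12 → EuclideanSpace ℝ (Fin 3), Function.Injective e ∧
        Set.range e = {w ∈ Y | w ≠ y ∧ dist y w ≤ a * (1 + 1 / 50)} ∧
        ((∀ i j : Fin 12, i < j → (dist (e i) (e j) ≤ a * (1 + 1 / 50) ↔
            (i.val, j.val) ∈ ([(0, 4), (0, 5), (0, 8), (0, 9), (1, 4), (1, 5), (1, 10), (1, 11), (2, 6), (2, 7),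
                (2, 8), (2, 9), (3, 6), (3, 7), (3, 10), (3, 11), (4, 8), (4, 10), (5, 9), (5, 11),
                (6, 8), (6, 10), (7, 9), (7, 11)] : List (ℕ × ℕ)))) ∨
          (∀ i j : Fin 12, i < j → (dist (e i) (e j) ≤ a * (1 + 1 / 50) ↔
            (i.val, j.val) ∈ ([(0, 2), (0, 5), (0, 7), (0, 10), (1, 3), (1, 4), (1, 8), (1, 11), (2, 4), (2, 6),
                (2, 9), (3, 5), (3, 8), (3, 11), (4, 6), (4, 9), (5, 7), (5, 10), (6, 7), (6, 8),
                (7, 8), (9, 10), (9, 11), (10, 11)] : List (ℕ × ℕ)))) ∨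
          (∀ i j : Fin 12, i < j → (dist (e i) (e j) ≤ a * (1 + 1 / 50) ↔
            (i.val, j.val) ∈ ([(0, 1), (0, 2), (0, 3), (0, 4), (0, 5), (1, 2), (1, 5), (1, 6), (2, 3), (2, 7), (3, 4),
                (3, 8), (4, 5), (4, 9), (5, 10), (6, 7), (6, 10), (6, 11), (7, 8), (7, 11), (8, 9),
                (8, 11), (9, 10), (9, 11), (10, 11)] : List (ℕ × ℕ)))))) →
      (∀ u ∈ Y, ∀ v ∈ Y, ∃ (n : ℕ) (g : ℕ → EuclideanSpace ℝ (Fin 3)), g 0 = u ∧ g n = v ∧ (∀ k, g k ∈ Y) ∧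
        (∀ k, k < n → dist (g k) (g (k + 1)) ≤ a * (1 + 1 / 50)) ∧ (n : ℝ) ≤ 4 * dist u v / a + 3) →
      (∀ y ∈ {y ∈ Y | ∃ v ∈ Y, v ≠ y ∧ dist y v ≤ a * (1 + 1 / 50) ∧
          5 ≤ {w ∈ Y | w ≠ y ∧ w ≠ v ∧ dist y w ≤ a * (1 + 1 / 50) ∧
            dist v w ≤ a * (1 + 1 / 50)}.ncard},
        ∀ y' ∈ {y ∈ Y | ∃ v ∈ Y, v ≠ y ∧ dist y v ≤ a * (1 + 1 / 50) ∧
          5 ≤ {w ∈ Y | w ≠ y ∧ w ≠ v ∧ dist y w ≤ a * (1 + 1 / 50) ∧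
            dist v w ≤ a * (1 + 1 / 50)}.ncard},
        ∃ f : ℕ → EuclideanSpace ℝ (Fin 3), f 0 = y ∧ (∀ n, f n ∈ Y) ∧
          (∀ n, f (n + 1) ∈ {v ∈ Y | v ≠ (f n) ∧ dist (f n) v ≤ a * (1 + 1 / 50) ∧
          5 ≤ {w ∈ Y | w ≠ (f n) ∧ w ≠ v ∧ dist (f n) w ≤ a * (1 + 1 / 50) ∧
            dist v w ≤ a * (1 + 1 / 50)}.ncard}) ∧
          ∃ n, f n = y') ∧
      (∃ h : EuclideanSpace ℝ (Fin 3) → ℝ,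
        (∀ u ∈ Y, ∀ v ∈ Y, dist u v ≤ a * (1 + 1 / 50) → |h u - h v| ≤ 1) ∧
        (∀ y ∈ Y, ∀ v ∈ {v ∈ Y | v ≠ y ∧ dist y v ≤ a * (1 + 1 / 50) ∧
          5 ≤ {w ∈ Y | w ≠ y ∧ w ≠ v ∧ dist y w ≤ a * (1 + 1 / 50) ∧
            dist v w ≤ a * (1 + 1 / 50)}.ncard},
          |h y - h v| = 1) ∧
        (∀ y ∈ Y, ∀ v ∈ {v ∈ Y | v ≠ y ∧ dist y v ≤ a * (1 + 1 / 50) ∧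
          5 ≤ {w ∈ Y | w ≠ y ∧ w ≠ v ∧ dist y w ≤ a * (1 + 1 / 50) ∧
            dist v w ≤ a * (1 + 1 / 50)}.ncard},
          ∀ v' ∈ {v ∈ Y | v ≠ y ∧ dist y v ≤ a * (1 + 1 / 50) ∧
          5 ≤ {w ∈ Y | w ≠ y ∧ w ≠ v ∧ dist y w ≤ a * (1 + 1 / 50) ∧
            dist v w ≤ a * (1 + 1 / 50)}.ncard},
          v ≠ v' → h v + h v' = 2 * h y)) :=
  stub_ffrRodTransfer stub_ffrRodGraph stub_ffrVolGrowth

/-- **Axis quasi-geodesy, composed** (Greedy + Rod.height + QuasiGlue). -/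
theorem ffr_axisQuasi_of :
    ∀ (Y : Set (EuclideanSpace ℝ (Fin 3))) (a : ℝ), 0 < a → Y.Nonempty →
      (∀ y ∈ Y, ({w ∈ Y | w ≠ y ∧ dist y w ≤ a * (1 + 1 / 50)}.ncard = 12 ∧
        ∀ w ∈ Y, w ≠ y → a * (1 - 1 / 50) ≤ dist y w ∧
          (dist y w ≤ a * (1 + 1 / 50) ∨ a * (63 / 50) ≤ dist y w))) →
      (∀ y ∈ Y, ∀ v ∈ Y, v ≠ y → dist y v ≤ a * (1 + 1 / 50) →
        4 ≤ {w ∈ Y | w ≠ y ∧ w ≠ v ∧ dist y w ≤ a * (1 + 1 / 50) ∧ dist v w ≤ a * (1 + 1 / 50)}.ncard) →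
      (∀ y ∈ Y, ∀ v ∈ Y, v ≠ y → dist y v ≤ a * (1 + 1 / 50) →
        {w ∈ Y | w ≠ y ∧ w ≠ v ∧ dist y w ≤ a * (1 + 1 / 50) ∧ dist v w ≤ a * (1 + 1 / 50)}.ncard ≤ 5) →
      (∀ y ∈ Y, Even {v ∈ Y | v ≠ y ∧ dist y v ≤ a * (1 + 1 / 50) ∧
          5 ≤ {w ∈ Y | w ≠ y ∧ w ≠ v ∧ dist y w ≤ a * (1 + 1 / 50) ∧
            dist v w ≤ a * (1 + 1 / 50)}.ncard}.ncard) →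
      (∀ y ∈ Y, {v ∈ Y | v ≠ y ∧ dist y v ≤ a * (1 + 1 / 50) ∧
          5 ≤ {w ∈ Y | w ≠ y ∧ w ≠ v ∧ dist y w ≤ a * (1 + 1 / 50) ∧
            dist v w ≤ a * (1 + 1 / 50)}.ncard} = ∅ ∨
        ({v ∈ Y | v ≠ y ∧ dist y v ≤ a * (1 + 1 / 50) ∧
          5 ≤ {w ∈ Y | w ≠ y ∧ w ≠ v ∧ dist y w ≤ a * (1 + 1 / 50) ∧
            dist v w ≤ a * (1 + 1 / 50)}.ncard}).ncard = 2) →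
      (∀ y₀ ∈ Y, ∀ v₀ ∈ {v ∈ Y | v ≠ y₀ ∧ dist y₀ v ≤ a * (1 + 1 / 50) ∧
          5 ≤ {w ∈ Y | w ≠ y₀ ∧ w ≠ v ∧ dist y₀ w ≤ a * (1 + 1 / 50) ∧
            dist v w ≤ a * (1 + 1 / 50)}.ncard},
        ∃ f : ℕ → EuclideanSpace ℝ (Fin 3), f 0 = y₀ ∧ f 1 = v₀ ∧ (∀ n, f n ∈ Y) ∧
          (∀ n, f (n + 1) ∈ {v ∈ Y | v ≠ (f n) ∧ dist (f n) v ≤ a * (1 + 1 / 50) ∧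
          5 ≤ {w ∈ Y | w ≠ (f n) ∧ w ≠ v ∧ dist (f n) w ≤ a * (1 + 1 / 50) ∧
            dist v w ≤ a * (1 + 1 / 50)}.ncard}) ∧
          (∀ n, f (n + 2) ≠ f n)) →
      (∀ y ∈ Y, ∃ e : Fin 12 → EuclideanSpace ℝ (Fin 3), Function.Injective e ∧
        Set.range e = {w ∈ Y | w ≠ y ∧ dist y w ≤ a * (1 + 1 / 50)} ∧
        ((∀ i j : Fin 12, i < j → (dist (e i) (e j) ≤ a * (1 + 1 / 50) ↔
            (i.val, j.val) ∈ ([(0, 4), (0, 5), (0, 8), (0, 9), (1, 4), (1, 5), (1, 10), (1, 11), (2, 6), (2, 7),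
                (2, 8), (2, 9), (3, 6), (3, 7), (3, 10), (3, 11), (4, 8), (4, 10), (5, 9), (5, 11),
                (6, 8), (6, 10), (7, 9), (7, 11)] : List (ℕ × ℕ)))) ∨
          (∀ i j : Fin 12, i < j → (dist (e i) (e j) ≤ a * (1 + 1 / 50) ↔
            (i.val, j.val) ∈ ([(0, 2), (0, 5), (0, 7), (0, 10), (1, 3), (1, 4), (1, 8), (1, 11), (2, 4), (2, 6),
                (2, 9), (3, 5), (3, 8), (3, 11), (4, 6), (4, 9), (5, 7), (5, 10), (6, 7), (6, 8),
                (7, 8), (9, 10), (9, 11), (10, 11)] : List (ℕ × ℕ)))) ∨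
          (∀ i j : Fin 12, i < j → (dist (e i) (e j) ≤ a * (1 + 1 / 50) ↔
            (i.val, j.val) ∈ ([(0, 1), (0, 2), (0, 3), (0, 4), (0, 5), (1, 2), (1, 5), (1, 6), (2, 3), (2, 7), (3, 4),
                (3, 8), (4, 5), (4, 9), (5, 10), (6, 7), (6, 10), (6, 11), (7, 8), (7, 11), (8, 9),
                (8, 11), (9, 10), (9, 11), (10, 11)] : List (ℕ × ℕ)))))) →
      (∃ c : ℝ, 0 < c ∧ ∀ f : ℕ → EuclideanSpace ℝ (Fin 3), (∀ n, f n ∈ Y) →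
        (∀ n, f (n + 1) ∈ {v ∈ Y | v ≠ (f n) ∧ dist (f n) v ≤ a * (1 + 1 / 50) ∧
          5 ≤ {w ∈ Y | w ≠ (f n) ∧ w ≠ v ∧ dist (f n) w ≤ a * (1 + 1 / 50) ∧
            dist v w ≤ a * (1 + 1 / 50)}.ncard}) →
        (∀ n, f (n + 2) ≠ f n) → ∀ i j : ℕ, c * |((i : ℝ) - j)| ≤ dist (f i) (f j)) :=
  fun Y a ha hne hgap htf hF1 hPar hN hW hL =>
    stub_ffrQuasiGlue Y a ha hgap (stub_ffrGreedy Y a ha hgap htf hL)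
      (ffr_rod_of Y a ha hne hgap htf hF1 hPar hN hW hL (stub_ffrGreedy Y a ha hgap htf hL)).2

/-- **Foam rigidity (point-set form), composed** (Rod.uniqueness + quasi-geodesy + landed FoamGlue). -/
theorem ffr_foamLineC_of :
    ∀ (Y : Set (EuclideanSpace ℝ (Fin 3))) (a : ℝ), 0 < a → Y.Nonempty →
      (∀ y ∈ Y, ({w ∈ Y | w ≠ y ∧ dist y w ≤ a * (1 + 1 / 50)}.ncard = 12 ∧
        ∀ w ∈ Y, w ≠ y → a * (1 - 1 / 50) ≤ dist y w ∧
          (dist y w ≤ a * (1 + 1 / 50) ∨ a * (63 / 50) ≤ dist y w))) →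
      (∀ y ∈ Y, ∀ v ∈ Y, v ≠ y → dist y v ≤ a * (1 + 1 / 50) →
        4 ≤ {w ∈ Y | w ≠ y ∧ w ≠ v ∧ dist y w ≤ a * (1 + 1 / 50) ∧ dist v w ≤ a * (1 + 1 / 50)}.ncard) →
      (∀ y ∈ Y, ∀ v ∈ Y, v ≠ y → dist y v ≤ a * (1 + 1 / 50) →
        {w ∈ Y | w ≠ y ∧ w ≠ v ∧ dist y w ≤ a * (1 + 1 / 50) ∧ dist v w ≤ a * (1 + 1 / 50)}.ncard ≤ 5) →
      (∀ y ∈ Y, Even {v ∈ Y | v ≠ y ∧ dist y v ≤ a * (1 + 1 / 50) ∧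
          5 ≤ {w ∈ Y | w ≠ y ∧ w ≠ v ∧ dist y w ≤ a * (1 + 1 / 50) ∧
            dist v w ≤ a * (1 + 1 / 50)}.ncard}.ncard) →
      (∀ y ∈ Y, {v ∈ Y | v ≠ y ∧ dist y v ≤ a * (1 + 1 / 50) ∧
          5 ≤ {w ∈ Y | w ≠ y ∧ w ≠ v ∧ dist y w ≤ a * (1 + 1 / 50) ∧
            dist v w ≤ a * (1 + 1 / 50)}.ncard} = ∅ ∨
        ({v ∈ Y | v ≠ y ∧ dist y v ≤ a * (1 + 1 / 50) ∧
          5 ≤ {w ∈ Y | w ≠ y ∧ w ≠ v ∧ dist y w ≤ a * (1 + 1 / 50) ∧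
            dist v w ≤ a * (1 + 1 / 50)}.ncard}).ncard = 2) →
      (∀ y₀ ∈ Y, ∀ v₀ ∈ {v ∈ Y | v ≠ y₀ ∧ dist y₀ v ≤ a * (1 + 1 / 50) ∧
          5 ≤ {w ∈ Y | w ≠ y₀ ∧ w ≠ v ∧ dist y₀ w ≤ a * (1 + 1 / 50) ∧
            dist v w ≤ a * (1 + 1 / 50)}.ncard},
        ∃ f : ℕ → EuclideanSpace ℝ (Fin 3), f 0 = y₀ ∧ f 1 = v₀ ∧ (∀ n, f n ∈ Y) ∧
          (∀ n, f (n + 1) ∈ {v ∈ Y | v ≠ (f n) ∧ dist (f n) v ≤ a * (1 + 1 / 50) ∧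
          5 ≤ {w ∈ Y | w ≠ (f n) ∧ w ≠ v ∧ dist (f n) w ≤ a * (1 + 1 / 50) ∧
            dist v w ≤ a * (1 + 1 / 50)}.ncard}) ∧
          (∀ n, f (n + 2) ≠ f n)) →
      (∀ y ∈ Y, ∃ e : Fin 12 → EuclideanSpace ℝ (Fin 3), Function.Injective e ∧
        Set.range e = {w ∈ Y | w ≠ y ∧ dist y w ≤ a * (1 + 1 / 50)} ∧
        ((∀ i j : Fin 12, i < j → (dist (e i) (e j) ≤ a * (1 + 1 / 50) ↔
            (i.val, j.val) ∈ ([(0, 4), (0, 5), (0, 8), (0, 9), (1, 4), (1, 5), (1, 10), (1, 11), (2, 6), (2, 7),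
                (2, 8), (2, 9), (3, 6), (3, 7), (3, 10), (3, 11), (4, 8), (4, 10), (5, 9), (5, 11),
                (6, 8), (6, 10), (7, 9), (7, 11)] : List (ℕ × ℕ)))) ∨
          (∀ i j : Fin 12, i < j → (dist (e i) (e j) ≤ a * (1 + 1 / 50) ↔
            (i.val, j.val) ∈ ([(0, 2), (0, 5), (0, 7), (0, 10), (1, 3), (1, 4), (1, 8), (1, 11), (2, 4), (2, 6),
                (2, 9), (3, 5), (3, 8), (3, 11), (4, 6), (4, 9), (5, 7), (5, 10), (6, 7), (6, 8),
                (7, 8), (9, 10), (9, 11), (10, 11)] : List (ℕ × ℕ)))) ∨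
          (∀ i j : Fin 12, i < j → (dist (e i) (e j) ≤ a * (1 + 1 / 50) ↔
            (i.val, j.val) ∈ ([(0, 1), (0, 2), (0, 3), (0, 4), (0, 5), (1, 2), (1, 5), (1, 6), (2, 3), (2, 7), (3, 4),
                (3, 8), (4, 5), (4, 9), (5, 10), (6, 7), (6, 10), (6, 11), (7, 8), (7, 11), (8, 9),
                (8, 11), (9, 10), (9, 11), (10, 11)] : List (ℕ × ℕ)))))) →
      ({y ∈ Y | ∃ v ∈ Y, v ≠ y ∧ dist y v ≤ a * (1 + 1 / 50) ∧
          5 ≤ {w ∈ Y | w ≠ y ∧ w ≠ v ∧ dist y w ≤ a * (1 + 1 / 50) ∧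
            dist v w ≤ a * (1 + 1 / 50)}.ncard} = ∅ ∨
        ∃ (z : ℤ → EuclideanSpace ℝ (Fin 3)) (c : ℝ), 0 < c ∧ (∀ i, z i ∈ Y) ∧
          (∀ i, dist (z i) (z (i + 1)) ≤ a * (1 + 1 / 50)) ∧
          (∀ i j : ℤ, c * |((i : ℝ) - j)| ≤ dist (z i) (z j)) ∧
          {y ∈ Y | ∃ v ∈ Y, v ≠ y ∧ dist y v ≤ a * (1 + 1 / 50) ∧
          5 ≤ {w ∈ Y | w ≠ y ∧ w ≠ v ∧ dist y w ≤ a * (1 + 1 / 50) ∧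
            dist v w ≤ a * (1 + 1 / 50)}.ncard} = Set.range z) :=
  fun Y a ha hne hgap htf hF1 hPar hN hW hL =>
    stub_ffrFoamGlue Y a ha hN hW
      (ffr_rod_of Y a ha hne hgap htf hF1 hPar hN hW hL (stub_ffrGreedy Y a ha hgap htf hL)).1
      (ffr_axisQuasi_of Y a ha hne hgap htf hF1 hPar hN hW hL)

/-- **The census (zero-density form), DERIVED**: link types ⇒ no branching ⇒ walks ⇒ five-sites on at
most one quasi-line ⇒ zero density. -/
theorem ffr_censusZ_of :
    ∀ (Y : Set (EuclideanSpace ℝ (Fin 3))) (a : ℝ), 0 < a → Y.Nonempty →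
      (∀ y ∈ Y, ({w ∈ Y | w ≠ y ∧ dist y w ≤ a * (1 + 1 / 50)}.ncard = 12 ∧
        ∀ w ∈ Y, w ≠ y → a * (1 - 1 / 50) ≤ dist y w ∧
          (dist y w ≤ a * (1 + 1 / 50) ∨ a * (63 / 50) ≤ dist y w))) →
      (∀ y ∈ Y, ∀ v ∈ Y, v ≠ y → dist y v ≤ a * (1 + 1 / 50) →
        4 ≤ {w ∈ Y | w ≠ y ∧ w ≠ v ∧ dist y w ≤ a * (1 + 1 / 50) ∧ dist v w ≤ a * (1 + 1 / 50)}.ncard) →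
      (∀ y ∈ Y, ∀ v ∈ Y, v ≠ y → dist y v ≤ a * (1 + 1 / 50) →
        {w ∈ Y | w ≠ y ∧ w ≠ v ∧ dist y w ≤ a * (1 + 1 / 50) ∧ dist v w ≤ a * (1 + 1 / 50)}.ncard ≤ 5) →
      (∀ y ∈ Y, Even {v ∈ Y | v ≠ y ∧ dist y v ≤ a * (1 + 1 / 50) ∧
          5 ≤ {w ∈ Y | w ≠ y ∧ w ≠ v ∧ dist y w ≤ a * (1 + 1 / 50) ∧
            dist v w ≤ a * (1 + 1 / 50)}.ncard}.ncard) →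
      (∀ p : EuclideanSpace ℝ (Fin 3), ∃ y ∈ Y, dist p y ≤ 3 * a) →
      ∀ ε : ℝ, 0 < ε → ∀ r₀ : ℝ, ∃ (p : EuclideanSpace ℝ (Fin 3)) (r : ℝ), r₀ ≤ r ∧
        (({y ∈ Y | ∃ v ∈ Y, v ≠ y ∧ dist y v ≤ a * (1 + 1 / 50) ∧
          5 ≤ {w ∈ Y | w ≠ y ∧ w ≠ v ∧ dist y w ≤ a * (1 + 1 / 50) ∧
            dist v w ≤ a * (1 + 1 / 50)}.ncard} ∩ Metric.closedBall p r).ncard : ℝ) ≤ ε * (r / a) ^ 3 := by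
  intro Y a ha hne hgap htf hF1 hPar _hRD
  have hL := ffr_linkTypes_of Y a ha hgap htf hF1
  have hN := stub_ffrTwoPoles Y a ha hgap htf hL
  have hW := stub_ffrChain Y a ha hN
  have hF := ffr_foamLineC_of Y a ha hne hgap htf hF1 hPar hN hW hL
  exact stub_ffrLineCensusC Y a ha hF

/-- **Composition (kernel-checked).** The crux `FiveFoldRationingR` BY NAME from the stubs and the landed
front layer: F1 (Lens + Circle + CommonLeFive), no free surface and relative denseness
(Lens + Circle + NoFreeSurface + RelDense), parity, the zero-density census (L + F + Q'), counting (CountingZ). -/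
theorem fiveFoldRationingR_of : FiveFoldRationingR := by
  intro Y a ha hne hgap htf
  have hF1 := stub_ffrCommonLeFive stub_ffrLens stub_ffrCircle.1 Y a ha hgap
  have hNFS := stub_ffrNoFreeSurface stub_ffrLens stub_ffrCircle.2 Y a ha hgap htf
  have hRD := stub_ffrRelDense Y a ha hne hgap hNFS
  have hPar := stub_ffrParity Y a ha hgap htf hF1
  have hZ := ffr_censusZ_of Y a ha hne hgap htf hF1 hPar hRD
  exact stub_ffrCountingZ Y a ha hne hgap hRD hZ

end Summit.AtomisticToContinuum.Crystallization.Theorems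

end
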